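import Mathlib
import Summits.ResolutionOfSingularities.ResolutionOfSingularities.Theses.RadicialJung
import Summits.ResolutionOfSingularities.ResolutionOfSingularities.Theorems.RadicialJungCleanModelsGradedAssembly
import HarnessLib

/-!
# Route `RadicialJung`, crux `CleanModels` (stmt-ResolutionOfSingularities-15917), skeleton `Cruxes/CleanModels/Lines/Sketch.lean` rev 35:
# the crux UP TO DIMENSION FOUR from the route's own support item `CleanAlongValuation4` (stmt-ResolutionOfSingularities-18006), the
# registered research stub X44c (`stub_cleanProp44`) and two-model patching in transcendence degree 4 — BY NAME

Explicit-unit seat `decomp-res-hand-2` g7 (share = stubs 5–7, strategy «structural»).  OURS, def-free, structural bookkeeping counted 0;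
nothing here proves resolution of singularities in characteristic `p`.

No `Theorems/` file mentioned the support item `Theses.RadicialJung.CleanAlongValuation4` (stmt-18006, «log-cleaning along ONE valuation,
base dimension ≤ 4») before this generation.  Its body quantifies over an ARBITRARY valuation ring `O ⊇ A₀` with regular centre of dimension
`≤ 4`; in particular it contains VERBATIM (up to reordering the conclusion) the graded zero-dimensional local input `CleanLUZeroDim_d` of the
skeleton for every `d ≤ 4` (`cleanLUZeroDim_of_cleanAlongValuation`, `cleanLUZeroDim_of_cleanAlongValuation4`).  Fed to the landed
all-dimension node ✓ `GradedAssembly.cleanModels_of_cleanLUZeroDim_of_cleanTwoModelPatching_allDim` (glue ✓ `cleanGlobalization_dim`, clean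
charts ✓ `cleanCharts_dim_of_cleanLUZeroDim_dim`, pointwise reduction ✓ `cleanModelsAt_of_logCleanPrincipalizationAt`, `dim ≤ 2` by F-75c ✓):

* `cleanModels_dimLEFour_of_cleanAlongValuation4` — **`CleanModels` restricted to `dim W ≤ 4` ⟸ stmt-18006 ∧ X44c ∧ hZ_4**: the support
  item REPLACES the five registered local stubs of the dim-3 slice (F-32 · F-02 · F-112 · wi-91399@2 · class (B)) AND the open local
  inputs of stub 7 at `d = 4` (ELU₄, class (B)₄, hand-2 g3–g6); what it does not replace is PATCHING: X44c (`hZ_3` ⟸ X44c alone, ✓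
  `GradedAssembly.cleanTwoModelPatching_three_of_cleanProp44`) and `hZ_4` (Piltant two-model patching for `P_clean` in trdeg 4, open).
* `cleanModels_of_cleanAlongValuation4_of_dimGEFive` — the crux BY NAME from the same three inputs plus the graded pair
  (`CleanLUZeroDim_d`, `hZ_d`) for `d ≥ 5`.

The converse direction (stmt-18006 ⟸ `CleanLUZeroDim_{≤ 4}`, hence stmt-18006 is EXACTLY the local half of the crux up to dimension 4) is
`…CleanAlongValuationOfZeroDim.lean` (this seat, same generation).
-/

noncomputable section

set_option linter.dupNamespace false -- mandated namespace of this single-conjunct summit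

open CategoryTheory AlgebraicGeometry IsLocalRing
open Literature.AlgebraicGeometry.Resolution Literature.AlgebraicGeometry.Motives
open Literature.AlgebraicGeometry.CossartPiltant200819

namespace Summit.ResolutionOfSingularities.ResolutionOfSingularities.Theorems.RadicialJung.CleanModels.GradedAssembly

/-! ## §1 The support item contains the graded zero-dimensional local input -/

/-- **`CleanLUZeroDim_d` for every `d ≤ N` from clean LU along one valuation at regular centres of dimension `≤ N`** (the body of
`Theses.RadicialJung.CleanAlongValuation4` with `4 ↦ N`): specialise the valuation to a zero-dimensional one and reorder the conclusion.
Pure logic. [folklore] -/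
theorem cleanLUZeroDim_of_cleanAlongValuation (N : ℕ)
    (hCAV : ∀ p : ℕ, p.Prime → ∀ (k K : Type) [Field k] [CharP k p] [Field K] [Algebra k K] (O : ValuationSubring K)
      (A₀ : Subalgebra k K) (h₀ : A₀.toSubring ≤ O.toSubring) (g : K), A₀.FG → IsFractionRing A₀ K → (∀ c : K, c ^ p ≠ g) →
      IsRegularLocalRing (locAtCentre A₀.toSubring O) →
      ringKrullDim (locAtCentre A₀.toSubring O) ≤ ((N : ℕ) : WithBot ℕ∞) →
      ∃ (A : Subalgebra k K) (_h : A.toSubring ≤ O.toSubring) (_ : IsRegularLocalRing (locAtCentre A.toSubring O)),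
        A₀ ≤ A ∧ A.FG ∧ ∃ c : Fin p → K, (∃ j : Fin p, (j : ℕ) ≠ 0 ∧ c j ≠ 0) ∧
        ((∃ (d m : ℕ) (hmd : m ≤ d) (t : Fin d → locAtCentre A.toSubring O) (a : Fin m → ℕ) (u : locAtCentre A.toSubring O),
            IsUnit u ∧ Ideal.span (Set.range t) = IsLocalRing.maximalIdeal (locAtCentre A.toSubring O) ∧
            ringKrullDim (locAtCentre A.toSubring O) = (d : WithBot ℕ∞) ∧ 0 < m ∧ (∀ i, ¬ p ∣ a i) ∧
            (∑ j : Fin p, c j ^ p * g ^ (j : ℕ)) =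
              (u : K) * ∏ i : Fin m, ((t (Fin.castLE hmd i) : locAtCentre A.toSubring O) : K) ^ (a i)) ∨
          (∃ u : locAtCentre A.toSubring O, IsUnit u ∧ (∑ j : Fin p, c j ^ p * g ^ (j : ℕ)) = (u : K) ∧
            ∀ c' : locAtCentre A.toSubring O, u - c' ^ p ∉ IsLocalRing.maximalIdeal (locAtCentre A.toSubring O)) ∨
          (∃ s c' : locAtCentre A.toSubring O, (∑ j : Fin p, c j ^ p * g ^ (j : ℕ)) = (s : K) ∧
            s - c' ^ p ∈ IsLocalRing.maximalIdeal (locAtCentre A.toSubring O) ∧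
            s - c' ^ p ∉ IsLocalRing.maximalIdeal (locAtCentre A.toSubring O) ^ 2))) :
    ∀ d : ℕ, d ≤ N → ∀ (p : ℕ), p.Prime →
    ∀ (k : Type) [Field k] [CharP k p] (K : Type) [Field K] [Algebra k K]
    (O : ValuationSubring K) (A : Subalgebra k K), A.toSubring ≤ O.toSubring → A.FG → IsFractionRing A K →
    ringKrullDim A ≤ (d : WithBot ℕ∞) → IsRegularLocalRing (locAtCentre A.toSubring O) →
    ringKrullDim (locAtCentre A.toSubring O) = (d : WithBot ℕ∞) →
    (∀ (T : Subring K) (hT : T ≤ O.toSubring), A.toSubring ≤ T → (subringCentre T O hT).IsMaximal) →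
    ∀ g₀ : K, (∀ c : K, c ^ p ≠ g₀) →
    ∃ (A' : Subalgebra k K), A'.toSubring ≤ O.toSubring ∧ A ≤ A' ∧ A'.FG ∧
    ∃ (_ : IsRegularLocalRing (locAtCentre A'.toSubring O)) (c : Fin p → K), (∃ j : Fin p, (j : ℕ) ≠ 0 ∧ c j ≠ 0) ∧
    ((∃ (d m : ℕ) (hmd : m ≤ d) (t : Fin d → ↥(locAtCentre A'.toSubring O)) (a : Fin m → ℕ) (u : ↥(locAtCentre A'.toSubring O)), IsUnit u ∧
    Ideal.span (Set.range t) = IsLocalRing.maximalIdeal ↥(locAtCentre A'.toSubring O) ∧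
    ringKrullDim ↥(locAtCentre A'.toSubring O) = (d : WithBot ℕ∞) ∧ 0 < m ∧ (∀ i, ¬ p ∣ a i) ∧
    (∑ j : Fin p, c j ^ p * g₀ ^ (j : ℕ)) = (u : K) * ∏ i : Fin m, ((t (Fin.castLE hmd i) : ↥(locAtCentre A'.toSubring O)) : K) ^ (a i)) ∨
    (∃ u : ↥(locAtCentre A'.toSubring O), IsUnit u ∧ (∑ j : Fin p, c j ^ p * g₀ ^ (j : ℕ)) = (u : K) ∧
    ∀ c' : ↥(locAtCentre A'.toSubring O), u - c' ^ p ∉ IsLocalRing.maximalIdeal ↥(locAtCentre A'.toSubring O)) ∨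
    (∃ s c' : ↥(locAtCentre A'.toSubring O), (∑ j : Fin p, c j ^ p * g₀ ^ (j : ℕ)) = (s : K) ∧
    s - c' ^ p ∈ IsLocalRing.maximalIdeal ↥(locAtCentre A'.toSubring O) ∧
    s - c' ^ p ∉ IsLocalRing.maximalIdeal ↥(locAtCentre A'.toSubring O) ^ 2)) := by
  intro d hdN p hp k _ _ K _ _ O A hAO hAfg hfrac _hdimA hreg hdim _hzd g₀ hg₀
  have hle : ringKrullDim (locAtCentre A.toSubring O) ≤ ((N : ℕ) : WithBot ℕ∞) := by
    rw [hdim]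
    exact_mod_cast hdN
  obtain ⟨A', hA'O, hregA', hAA', hA'fg, c, hc, hform⟩ := hCAV p hp k K O A hAO g₀ hAfg hfrac hg₀ hreg hle
  exact ⟨A', hA'O, hAA', hA'fg, hregA', c, hc, hform⟩

/-- **The support item `CleanAlongValuation4` (stmt-ResolutionOfSingularities-18006) implies the skeleton's graded zero-dimensional local input
`CleanLUZeroDim_d` for every `d ≤ 4`** — in particular the dim-3 node `cleanLU3_of_stubs` (statement) and the `d = 4` local input of stub 7.
BY NAME; pure logic. [folklore] -/
theorem cleanLUZeroDim_of_cleanAlongValuation4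
    (h18006 : Summit.ResolutionOfSingularities.ResolutionOfSingularities.Theses.RadicialJung.CleanAlongValuation4) :
    ∀ d : ℕ, d ≤ 4 → ∀ (p : ℕ), p.Prime →
    ∀ (k : Type) [Field k] [CharP k p] (K : Type) [Field K] [Algebra k K]
    (O : ValuationSubring K) (A : Subalgebra k K), A.toSubring ≤ O.toSubring → A.FG → IsFractionRing A K →
    ringKrullDim A ≤ (d : WithBot ℕ∞) → IsRegularLocalRing (locAtCentre A.toSubring O) →
    ringKrullDim (locAtCentre A.toSubring O) = (d : WithBot ℕ∞) →
    (∀ (T : Subring K) (hT : T ≤ O.toSubring), A.toSubring ≤ T → (subringCentre T O hT).IsMaximal) →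
    ∀ g₀ : K, (∀ c : K, c ^ p ≠ g₀) →
    ∃ (A' : Subalgebra k K), A'.toSubring ≤ O.toSubring ∧ A ≤ A' ∧ A'.FG ∧
    ∃ (_ : IsRegularLocalRing (locAtCentre A'.toSubring O)) (c : Fin p → K), (∃ j : Fin p, (j : ℕ) ≠ 0 ∧ c j ≠ 0) ∧
    ((∃ (d m : ℕ) (hmd : m ≤ d) (t : Fin d → ↥(locAtCentre A'.toSubring O)) (a : Fin m → ℕ) (u : ↥(locAtCentre A'.toSubring O)), IsUnit u ∧
    Ideal.span (Set.range t) = IsLocalRing.maximalIdeal ↥(locAtCentre A'.toSubring O) ∧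
    ringKrullDim ↥(locAtCentre A'.toSubring O) = (d : WithBot ℕ∞) ∧ 0 < m ∧ (∀ i, ¬ p ∣ a i) ∧
    (∑ j : Fin p, c j ^ p * g₀ ^ (j : ℕ)) = (u : K) * ∏ i : Fin m, ((t (Fin.castLE hmd i) : ↥(locAtCentre A'.toSubring O)) : K) ^ (a i)) ∨
    (∃ u : ↥(locAtCentre A'.toSubring O), IsUnit u ∧ (∑ j : Fin p, c j ^ p * g₀ ^ (j : ℕ)) = (u : K) ∧
    ∀ c' : ↥(locAtCentre A'.toSubring O), u - c' ^ p ∉ IsLocalRing.maximalIdeal ↥(locAtCentre A'.toSubring O)) ∨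
    (∃ s c' : ↥(locAtCentre A'.toSubring O), (∑ j : Fin p, c j ^ p * g₀ ^ (j : ℕ)) = (s : K) ∧
    s - c' ^ p ∈ IsLocalRing.maximalIdeal ↥(locAtCentre A'.toSubring O) ∧
    s - c' ^ p ∉ IsLocalRing.maximalIdeal ↥(locAtCentre A'.toSubring O) ^ 2)) :=
  cleanLUZeroDim_of_cleanAlongValuation 4 h18006

/-! ## §2 The crux up to dimension four from stmt-18006, X44c and `hZ_4` -/

/-- **`CleanModels` RESTRICTED TO `dim W ≤ 4` ⟸ stmt-18006 ∧ X44c ∧ hZ_4.**  `dim W ≤ 2`: F-75c (✓ `stub_stacks0BICLocus`,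
✓ `cleanModels_dimLETwo_of_f75c`); `dim W = d ∈ {3, 4}`: ✓ `cleanModelsAt_of_logCleanPrincipalizationAt` over ✓ `cleanGlobalization_dim`, fed with
✓ `cleanCharts_dim_of_cleanLUZeroDim_dim (cleanLUZeroDim_of_cleanAlongValuation4 h18006 d _)` and with `hZ_3` ⟸ X44c (✓
`cleanTwoModelPatching_three_of_cleanProp44`) resp. the hypothesis `hZ4`.  The hypotheses `h44c` and `hZ4` are VERBATIM the registered stub
`stub_cleanProp44` and the `d = 4` instance of the graded patching input of ✓ `cleanModels_of_cleanLUZeroDim_of_cleanTwoModelPatching_allDim`.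
Structural reduction only (all three inputs open). [cite: Piltant2013, Prop. 5.1 and Cor. 5.7] [cite: CossartPiltant2008, Prop. 4.4] -/
theorem cleanModels_dimLEFour_of_cleanAlongValuation4
    (h18006 : Summit.ResolutionOfSingularities.ResolutionOfSingularities.Theses.RadicialJung.CleanAlongValuation4)
    (h44c : ∀ (p : ℕ), p.Prime → ∀ (S : Scheme.{0}) [IsIntegral S] [IsNoetherian S],
      CharP S.functionField p → Scheme.IsRegular S → Scheme.IsExcellent S → topologicalKrullDim S = 3 →
      ∀ G₀ : S.functionField, (∀ s : S, CleanRegAt p (algebraMap (S.presheaf.stalk s) S.functionField) G₀) →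
      ∀ I : S.IdealSheafData, I ≠ ⊥ →
      ∀ (X : Scheme.{0}) (ρ : X ⟶ S) [IsIntegral X] [IsNoetherian X] [IsDominant ρ],
        IsCleanRegularCentreBlowupSeq p ρ I G₀ →
        (∀ x : X, CleanRegAt p (algebraMap (X.presheaf.stalk x) X.functionField) (RatFn.functionFieldMap ρ G₀)) →
        ∀ (J : X.IdealSheafData) (μ : ℕ), 1 ≤ μ →
          (∀ x ∈ J.support, 1 < Order.coheight x) → (∀ x, idealOrder J x ≤ μ) → (∃ x, idealOrder J x = μ) →
          ∃ (X' : Scheme.{0}) (π : X' ⟶ X) (_ : IsIntegral X') (_ : IsDominant π) (J' : X'.IdealSheafData),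
            IsCleanPermissibleSeq p π J μ J' (RatFn.functionFieldMap ρ G₀) ∧ ∀ x, idealOrder J' x < μ)
    (hZ4 : ∀ (p : ℕ), p.Prime → ∀ (k K : Type) [Field k] [CharP k p] [Field K] [Algebra k K] [Algebra.EssFiniteType k K],
    Algebra.trdeg k K = ((4 : ℕ) : Cardinal) → ∀ (g₀ : K) (M₁ M₂ : ProjModel k K) (U₁ : M₁.X.Opens) (U₂ : M₂.X.Opens),
    (∀ x ∈ U₁, ModelCleanRegAt p g₀ M₁ x) → (∀ x ∈ U₂, ModelCleanRegAt p g₀ M₂ x) →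
    ∃ (N : ProjModel k K) (φ₁ : N.Hom M₁) (φ₂ : N.Hom M₂),
    (∀ y : N.X, φ₁.f y ∈ U₁ → ModelCleanRegAt p g₀ N y) ∧ (∀ y : N.X, φ₂.f y ∈ U₂ → ModelCleanRegAt p g₀ N y)) :
    ∀ p : ℕ, p.Prime → ∀ (k : Type) [Field k] [CharP k p] (W : AlgebraicGeometry.Scheme.{0}) [AlgebraicGeometry.IsIntegral W] (f : W ⟶ AlgebraicGeometry.Spec (.of k)) (L : Type) [Field L] [Algebra W.functionField L], AlgebraicGeometry.IsSeparated f → AlgebraicGeometry.LocallyOfFiniteType f → AlgebraicGeometry.QuasiCompact f → Literature.AlgebraicGeometry.Resolution.Scheme.IsRegular W → IsPurelyInseparable W.functionField L → Module.finrank W.functionField L = p → topologicalKrullDim W ≤ ((4 : ℕ) : WithBot ℕ∞) → ∃ (V : AlgebraicGeometry.Scheme.{0}) (π : V ⟶ W) (_ : AlgebraicGeometry.IsIntegral V) (_ : AlgebraicGeometry.IsDominant π), AlgebraicGeometry.IsProper π ∧ Literature.AlgebraicGeometry.Resolution.IsBirational π ∧ Literature.AlgebraicGeometry.Resolution.Scheme.IsRegular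 V ∧ (∀ v : V, (∃ (y : L) (g : W.functionField), y ∉ Set.range (algebraMap W.functionField L) ∧ algebraMap W.functionField L g = y ^ p ∧ ((∃ (d m : ℕ) (hmd : m ≤ d) (t : Fin d → V.presheaf.stalk v) (a : Fin m → ℕ), Ideal.span (Set.range t) = IsLocalRing.maximalIdeal (V.presheaf.stalk v) ∧ ringKrullDim (V.presheaf.stalk v) = (d : WithBot ℕ∞) ∧ 0 < m ∧ (∀ i, ¬ p ∣ a i) ∧ Literature.AlgebraicGeometry.Motives.RatFn.functionFieldMap π g = ∏ i : Fin m, (algebraMap (V.presheaf.stalk v) V.functionField (t (Fin.castLE hmd i))) ^ (a i)) ∨ (∃ u₀ : V.presheaf.stalk v, IsUnit u₀ ∧ Literature.AlgebraicGeometry.Motives.RatFn.functionFieldMap π g = algebraMap (V.presheaf.stalk v) V.functionField u₀ ∧ ((∀ c : V.presheaf.stalk v, u₀ - c ^ p ∉ IsLocalRing.maximalIdeal (V.presheaf.stalk v)) ∨ (∃ c : V.presheaf.stalk v, u₀ - c ^ p ∈ IsLocalRing.maximalIdeal (V.presheaf.stalk v) ∧ u₀ - c ^ p ∉ IsLocalRing.maximalIdeal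 (V.presheaf.stalk v) ^ 2)))))) := by
  intro p hp k _ _ W _ f L _ _ hs hl hq hr hpi hd h4
  haveI := hs; haveI := hl; haveI := hq
  by_cases h2 : topologicalKrullDim W ≤ 2
  · haveI := hpi
    exact cleanModels_dimLETwo_of_f75c stub_stacks0BICLocus p hp k W f hr L hd h2
  · obtain ⟨d, hdW⟩ := exists_nat_topologicalKrullDim_eq f
    have h3 : 3 ≤ d := by
      by_contra hlt
      apply h2
      rw [hdW]
      exact_mod_cast Nat.lt_succ_iff.mp (not_le.mp hlt)
    have hd4 : d ≤ 4 := by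
      rw [hdW] at h4
      exact_mod_cast h4
    have hLU := cleanLUZeroDim_of_cleanAlongValuation4 h18006 d hd4
    have hZ : ∀ (p : ℕ), p.Prime → ∀ (k K : Type) [Field k] [CharP k p] [Field K] [Algebra k K] [Algebra.EssFiniteType k K],
    Algebra.trdeg k K = (d : Cardinal) → ∀ (g₀ : K) (M₁ M₂ : ProjModel k K) (U₁ : M₁.X.Opens) (U₂ : M₂.X.Opens),
    (∀ x ∈ U₁, ModelCleanRegAt p g₀ M₁ x) → (∀ x ∈ U₂, ModelCleanRegAt p g₀ M₂ x) →
    ∃ (N : ProjModel k K) (φ₁ : N.Hom M₁) (φ₂ : N.Hom M₂),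
    (∀ y : N.X, φ₁.f y ∈ U₁ → ModelCleanRegAt p g₀ N y) ∧ (∀ y : N.X, φ₂.f y ∈ U₂ → ModelCleanRegAt p g₀ N y) := by
      by_cases hd3 : d = 3
      · subst hd3
        exact cleanTwoModelPatching_three_of_cleanProp44 h44c
      · have hd4' : d = 4 := by omega
        subst hd4'
        exact hZ4
    exact cleanModelsAt_of_logCleanPrincipalizationAt p hp k W f L hpi hd
      (fun g₀ hg₀ => cleanGlobalization_dim (cleanCharts_dim_of_cleanLUZeroDim_dim hLU) hZ p hp k W f hr hdW g₀ hg₀)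

/-- **The crux `RadicialJung.CleanModels` BY NAME from stmt-18006, X44c, `hZ_4` and the graded pair for `d ≥ 5`** (`CleanLUZeroDim_d`,
`hZ_d`; both open — in dimension `≥ 5` even the Novacoski–Spivakovsky rank reduction of hand-2 g4–g6 needs embedded resolution of divisors in
regular `(d-1)`-folds, not in print).  Through the one node ✓ `cleanModels_of_cleanLUZeroDim_of_cleanTwoModelPatching_allDim` by cases
`d ≤ 4` / `d = 3` / otherwise.  Structural reduction only. [cite: Piltant2013, Prop. 5.1 and Cor. 5.7] [cite: CutkoskyMourtada2019, Def. 1.2] -/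
theorem cleanModels_of_cleanAlongValuation4_of_dimGEFive
    (h18006 : Summit.ResolutionOfSingularities.ResolutionOfSingularities.Theses.RadicialJung.CleanAlongValuation4)
    (h44c : ∀ (p : ℕ), p.Prime → ∀ (S : Scheme.{0}) [IsIntegral S] [IsNoetherian S],
      CharP S.functionField p → Scheme.IsRegular S → Scheme.IsExcellent S → topologicalKrullDim S = 3 →
      ∀ G₀ : S.functionField, (∀ s : S, CleanRegAt p (algebraMap (S.presheaf.stalk s) S.functionField) G₀) →
      ∀ I : S.IdealSheafData, I ≠ ⊥ →
      ∀ (X : Scheme.{0}) (ρ : X ⟶ S) [IsIntegral X] [IsNoetherian X] [IsDominant ρ],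
        IsCleanRegularCentreBlowupSeq p ρ I G₀ →
        (∀ x : X, CleanRegAt p (algebraMap (X.presheaf.stalk x) X.functionField) (RatFn.functionFieldMap ρ G₀)) →
        ∀ (J : X.IdealSheafData) (μ : ℕ), 1 ≤ μ →
          (∀ x ∈ J.support, 1 < Order.coheight x) → (∀ x, idealOrder J x ≤ μ) → (∃ x, idealOrder J x = μ) →
          ∃ (X' : Scheme.{0}) (π : X' ⟶ X) (_ : IsIntegral X') (_ : IsDominant π) (J' : X'.IdealSheafData),
            IsCleanPermissibleSeq p π J μ J' (RatFn.functionFieldMap ρ G₀) ∧ ∀ x, idealOrder J' x < μ)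
    (hZ4 : ∀ (p : ℕ), p.Prime → ∀ (k K : Type) [Field k] [CharP k p] [Field K] [Algebra k K] [Algebra.EssFiniteType k K],
    Algebra.trdeg k K = ((4 : ℕ) : Cardinal) → ∀ (g₀ : K) (M₁ M₂ : ProjModel k K) (U₁ : M₁.X.Opens) (U₂ : M₂.X.Opens),
    (∀ x ∈ U₁, ModelCleanRegAt p g₀ M₁ x) → (∀ x ∈ U₂, ModelCleanRegAt p g₀ M₂ x) →
    ∃ (N : ProjModel k K) (φ₁ : N.Hom M₁) (φ₂ : N.Hom M₂),
    (∀ y : N.X, φ₁.f y ∈ U₁ → ModelCleanRegAt p g₀ N y) ∧ (∀ y : N.X, φ₂.f y ∈ U₂ → ModelCleanRegAt p g₀ N y))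
    (hLU5 : ∀ d : ℕ, 5 ≤ d → ∀ (p : ℕ), p.Prime →
    ∀ (k : Type) [Field k] [CharP k p] (K : Type) [Field K] [Algebra k K]
    (O : ValuationSubring K) (A : Subalgebra k K), A.toSubring ≤ O.toSubring → A.FG → IsFractionRing A K →
    ringKrullDim A ≤ (d : WithBot ℕ∞) → IsRegularLocalRing (locAtCentre A.toSubring O) →
    ringKrullDim (locAtCentre A.toSubring O) = (d : WithBot ℕ∞) →
    (∀ (T : Subring K) (hT : T ≤ O.toSubring), A.toSubring ≤ T → (subringCentre T O hT).IsMaximal) →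
    ∀ g₀ : K, (∀ c : K, c ^ p ≠ g₀) →
    ∃ (A' : Subalgebra k K), A'.toSubring ≤ O.toSubring ∧ A ≤ A' ∧ A'.FG ∧
    ∃ (_ : IsRegularLocalRing (locAtCentre A'.toSubring O)) (c : Fin p → K), (∃ j : Fin p, (j : ℕ) ≠ 0 ∧ c j ≠ 0) ∧
    ((∃ (d m : ℕ) (hmd : m ≤ d) (t : Fin d → ↥(locAtCentre A'.toSubring O)) (a : Fin m → ℕ) (u : ↥(locAtCentre A'.toSubring O)), IsUnit u ∧
    Ideal.span (Set.range t) = IsLocalRing.maximalIdeal ↥(locAtCentre A'.toSubring O) ∧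
    ringKrullDim ↥(locAtCentre A'.toSubring O) = (d : WithBot ℕ∞) ∧ 0 < m ∧ (∀ i, ¬ p ∣ a i) ∧
    (∑ j : Fin p, c j ^ p * g₀ ^ (j : ℕ)) = (u : K) * ∏ i : Fin m, ((t (Fin.castLE hmd i) : ↥(locAtCentre A'.toSubring O)) : K) ^ (a i)) ∨
    (∃ u : ↥(locAtCentre A'.toSubring O), IsUnit u ∧ (∑ j : Fin p, c j ^ p * g₀ ^ (j : ℕ)) = (u : K) ∧
    ∀ c' : ↥(locAtCentre A'.toSubring O), u - c' ^ p ∉ IsLocalRing.maximalIdeal ↥(locAtCentre A'.toSubring O)) ∨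
    (∃ s c' : ↥(locAtCentre A'.toSubring O), (∑ j : Fin p, c j ^ p * g₀ ^ (j : ℕ)) = (s : K) ∧
    s - c' ^ p ∈ IsLocalRing.maximalIdeal ↥(locAtCentre A'.toSubring O) ∧
    s - c' ^ p ∉ IsLocalRing.maximalIdeal ↥(locAtCentre A'.toSubring O) ^ 2)))
    (hZ5 : ∀ d : ℕ, 5 ≤ d → ∀ (p : ℕ), p.Prime → ∀ (k K : Type) [Field k] [CharP k p] [Field K] [Algebra k K] [Algebra.EssFiniteType k K],
    Algebra.trdeg k K = d → ∀ (g₀ : K) (M₁ M₂ : ProjModel k K) (U₁ : M₁.X.Opens) (U₂ : M₂.X.Opens),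
    (∀ x ∈ U₁, ModelCleanRegAt p g₀ M₁ x) → (∀ x ∈ U₂, ModelCleanRegAt p g₀ M₂ x) →
    ∃ (N : ProjModel k K) (φ₁ : N.Hom M₁) (φ₂ : N.Hom M₂),
    (∀ y : N.X, φ₁.f y ∈ U₁ → ModelCleanRegAt p g₀ N y) ∧ (∀ y : N.X, φ₂.f y ∈ U₂ → ModelCleanRegAt p g₀ N y)) :
    Summit.ResolutionOfSingularities.ResolutionOfSingularities.Theses.RadicialJung.CleanModels := by
  refine cleanModels_of_cleanLUZeroDim_of_cleanTwoModelPatching_allDim (fun d hd => ?_) (fun d hd => ?_)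
  · by_cases hd4 : d ≤ 4
    · exact cleanLUZeroDim_of_cleanAlongValuation4 h18006 d hd4
    · exact hLU5 d (by omega)
  · by_cases hd3 : d = 3
    · subst hd3
      exact cleanTwoModelPatching_three_of_cleanProp44 h44c
    · by_cases hd4 : d = 4
      · subst hd4
        exact hZ4
      · exact hZ5 d (by omega)

/-! ## §3 (appended, same seat) The general form: the crux up to dimension `N` from clean LU along one valuation and patching in degrees `3 … N` -/

/-- **`CleanModels` RESTRICTED TO `dim W ≤ N` ⟸ (clean LU along one valuation at regular centres of dim ≤ N) ∧ (two-model patching for `P_clean` in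
every transcendence degree `3 ≤ d ≤ N`)** — the general form of `cleanModels_dimLEFour_of_cleanAlongValuation4` (which is `N = 4` with `hZ_3`
discharged from X44c).  Same proof: `dim W ≤ 2` by F-75c ✓; `dim W = d ∈ [3, N]` through ✓ `cleanModelsAt_of_logCleanPrincipalizationAt` ∘ ✓
`cleanGlobalization_dim` ∘ ✓ `cleanCharts_dim_of_cleanLUZeroDim_dim (cleanLUZeroDim_of_cleanAlongValuation N hCAV d _)`.  Structural reduction only.
[cite: Piltant2013, Prop. 5.1 and Cor. 5.7] -/
theorem cleanModels_dimLE_of_cleanAlongValuation (N : ℕ)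
    (hCAV : ∀ p : ℕ, p.Prime → ∀ (k K : Type) [Field k] [CharP k p] [Field K] [Algebra k K] (O : ValuationSubring K)
      (A₀ : Subalgebra k K) (h₀ : A₀.toSubring ≤ O.toSubring) (g : K), A₀.FG → IsFractionRing A₀ K → (∀ c : K, c ^ p ≠ g) →
      IsRegularLocalRing (locAtCentre A₀.toSubring O) →
      ringKrullDim (locAtCentre A₀.toSubring O) ≤ ((N : ℕ) : WithBot ℕ∞) →
      ∃ (A : Subalgebra k K) (_h : A.toSubring ≤ O.toSubring) (_ : IsRegularLocalRing (locAtCentre A.toSubring O)),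
        A₀ ≤ A ∧ A.FG ∧ ∃ c : Fin p → K, (∃ j : Fin p, (j : ℕ) ≠ 0 ∧ c j ≠ 0) ∧
        ((∃ (d m : ℕ) (hmd : m ≤ d) (t : Fin d → locAtCentre A.toSubring O) (a : Fin m → ℕ) (u : locAtCentre A.toSubring O),
            IsUnit u ∧ Ideal.span (Set.range t) = IsLocalRing.maximalIdeal (locAtCentre A.toSubring O) ∧
            ringKrullDim (locAtCentre A.toSubring O) = (d : WithBot ℕ∞) ∧ 0 < m ∧ (∀ i, ¬ p ∣ a i) ∧
            (∑ j : Fin p, c j ^ p * g ^ (j : ℕ)) =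
              (u : K) * ∏ i : Fin m, ((t (Fin.castLE hmd i) : locAtCentre A.toSubring O) : K) ^ (a i)) ∨
          (∃ u : locAtCentre A.toSubring O, IsUnit u ∧ (∑ j : Fin p, c j ^ p * g ^ (j : ℕ)) = (u : K) ∧
            ∀ c' : locAtCentre A.toSubring O, u - c' ^ p ∉ IsLocalRing.maximalIdeal (locAtCentre A.toSubring O)) ∨
          (∃ s c' : locAtCentre A.toSubring O, (∑ j : Fin p, c j ^ p * g ^ (j : ℕ)) = (s : K) ∧
            s - c' ^ p ∈ IsLocalRing.maximalIdeal (locAtCentre A.toSubring O) ∧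
            s - c' ^ p ∉ IsLocalRing.maximalIdeal (locAtCentre A.toSubring O) ^ 2)))
    (hZ : ∀ d : ℕ, 3 ≤ d → d ≤ N → ∀ (p : ℕ), p.Prime → ∀ (k K : Type) [Field k] [CharP k p] [Field K] [Algebra k K] [Algebra.EssFiniteType k K],
    Algebra.trdeg k K = d → ∀ (g₀ : K) (M₁ M₂ : ProjModel k K) (U₁ : M₁.X.Opens) (U₂ : M₂.X.Opens),
    (∀ x ∈ U₁, ModelCleanRegAt p g₀ M₁ x) → (∀ x ∈ U₂, ModelCleanRegAt p g₀ M₂ x) →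
    ∃ (N : ProjModel k K) (φ₁ : N.Hom M₁) (φ₂ : N.Hom M₂),
    (∀ y : N.X, φ₁.f y ∈ U₁ → ModelCleanRegAt p g₀ N y) ∧ (∀ y : N.X, φ₂.f y ∈ U₂ → ModelCleanRegAt p g₀ N y)) :
    ∀ p : ℕ, p.Prime → ∀ (k : Type) [Field k] [CharP k p] (W : AlgebraicGeometry.Scheme.{0}) [AlgebraicGeometry.IsIntegral W] (f : W ⟶ AlgebraicGeometry.Spec (.of k)) (L : Type) [Field L] [Algebra W.functionField L], AlgebraicGeometry.IsSeparated f → AlgebraicGeometry.LocallyOfFiniteType f → AlgebraicGeometry.QuasiCompact f → Literature.AlgebraicGeometry.Resolution.Scheme.IsRegular W → IsPurelyInseparable W.functionField L → Module.finrank W.functionField L = p → topologicalKrullDim W ≤ ((N : ℕ) : WithBot ℕ∞) → ∃ (V : AlgebraicGeometry.Scheme.{0}) (π : V ⟶ W) (_ : AlgebraicGeometry.IsIntegral V) (_ : AlgebraicGeometry.IsDominant π), AlgebraicGeometry.IsProper π ∧ Literature.AlgebraicGeometry.Resolution.IsBirational π ∧ Literature.AlgebraicGeometry.Resolution.Scheme.IsRegular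 V ∧ (∀ v : V, (∃ (y : L) (g : W.functionField), y ∉ Set.range (algebraMap W.functionField L) ∧ algebraMap W.functionField L g = y ^ p ∧ ((∃ (d m : ℕ) (hmd : m ≤ d) (t : Fin d → V.presheaf.stalk v) (a : Fin m → ℕ), Ideal.span (Set.range t) = IsLocalRing.maximalIdeal (V.presheaf.stalk v) ∧ ringKrullDim (V.presheaf.stalk v) = (d : WithBot ℕ∞) ∧ 0 < m ∧ (∀ i, ¬ p ∣ a i) ∧ Literature.AlgebraicGeometry.Motives.RatFn.functionFieldMap π g = ∏ i : Fin m, (algebraMap (V.presheaf.stalk v) V.functionField (t (Fin.castLE hmd i))) ^ (a i)) ∨ (∃ u₀ : V.presheaf.stalk v, IsUnit u₀ ∧ Literature.AlgebraicGeometry.Motives.RatFn.functionFieldMap π g = algebraMap (V.presheaf.stalk v) V.functionField u₀ ∧ ((∀ c : V.presheaf.stalk v, u₀ - c ^ p ∉ IsLocalRing.maximalIdeal (V.presheaf.stalk v)) ∨ (∃ c : V.presheaf.stalk v, u₀ - c ^ p ∈ IsLocalRing.maximalIdeal (V.presheaf.stalk v) ∧ u₀ - c ^ p ∉ IsLocalRing.maximalIdeal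 (V.presheaf.stalk v) ^ 2)))))) := by
  intro p hp k _ _ W _ f L _ _ hs hl hq hr hpi hd hN
  haveI := hs; haveI := hl; haveI := hq
  by_cases h2 : topologicalKrullDim W ≤ 2
  · haveI := hpi
    exact cleanModels_dimLETwo_of_f75c stub_stacks0BICLocus p hp k W f hr L hd h2
  · obtain ⟨d, hdW⟩ := exists_nat_topologicalKrullDim_eq f
    have h3 : 3 ≤ d := by
      by_contra hlt
      apply h2
      rw [hdW]
      exact_mod_cast Nat.lt_succ_iff.mp (not_le.mp hlt)
    have hdN : d ≤ N := by
      rw [hdW] at hN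
      exact_mod_cast hN
    exact cleanModelsAt_of_logCleanPrincipalizationAt p hp k W f L hpi hd
      (fun g₀ hg₀ => cleanGlobalization_dim (cleanCharts_dim_of_cleanLUZeroDim_dim (cleanLUZeroDim_of_cleanAlongValuation N hCAV d hdN))
        (hZ d h3 hdN) p hp k W f hr hdW g₀ hg₀)

/-- **`CleanModels` RESTRICTED TO `dim W ≤ 3` ⟸ (clean LU along one valuation at regular centres of dim ≤ 3) ∧ X44c** — the `N = 3` instance,
with `hZ_3` discharged from the registered research stub `stub_cleanProp44` (VERBATIM as `h44c`) by ✓ `cleanTwoModelPatching_three_of_cleanProp44`.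
[cite: CossartPiltant2008, Prop. 4.4] [cite: Piltant2013, Prop. 5.1] -/
theorem cleanModels_dimLEThree_of_cleanAlongValuation3
    (hCAV : ∀ p : ℕ, p.Prime → ∀ (k K : Type) [Field k] [CharP k p] [Field K] [Algebra k K] (O : ValuationSubring K)
      (A₀ : Subalgebra k K) (h₀ : A₀.toSubring ≤ O.toSubring) (g : K), A₀.FG → IsFractionRing A₀ K → (∀ c : K, c ^ p ≠ g) →
      IsRegularLocalRing (locAtCentre A₀.toSubring O) →
      ringKrullDim (locAtCentre A₀.toSubring O) ≤ ((3 : ℕ) : WithBot ℕ∞) →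
      ∃ (A : Subalgebra k K) (_h : A.toSubring ≤ O.toSubring) (_ : IsRegularLocalRing (locAtCentre A.toSubring O)),
        A₀ ≤ A ∧ A.FG ∧ ∃ c : Fin p → K, (∃ j : Fin p, (j : ℕ) ≠ 0 ∧ c j ≠ 0) ∧
        ((∃ (d m : ℕ) (hmd : m ≤ d) (t : Fin d → locAtCentre A.toSubring O) (a : Fin m → ℕ) (u : locAtCentre A.toSubring O),
            IsUnit u ∧ Ideal.span (Set.range t) = IsLocalRing.maximalIdeal (locAtCentre A.toSubring O) ∧
            ringKrullDim (locAtCentre A.toSubring O) = (d : WithBot ℕ∞) ∧ 0 < m ∧ (∀ i, ¬ p ∣ a i) ∧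
            (∑ j : Fin p, c j ^ p * g ^ (j : ℕ)) =
              (u : K) * ∏ i : Fin m, ((t (Fin.castLE hmd i) : locAtCentre A.toSubring O) : K) ^ (a i)) ∨
          (∃ u : locAtCentre A.toSubring O, IsUnit u ∧ (∑ j : Fin p, c j ^ p * g ^ (j : ℕ)) = (u : K) ∧
            ∀ c' : locAtCentre A.toSubring O, u - c' ^ p ∉ IsLocalRing.maximalIdeal (locAtCentre A.toSubring O)) ∨
          (∃ s c' : locAtCentre A.toSubring O, (∑ j : Fin p, c j ^ p * g ^ (j : ℕ)) = (s : K) ∧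
            s - c' ^ p ∈ IsLocalRing.maximalIdeal (locAtCentre A.toSubring O) ∧
            s - c' ^ p ∉ IsLocalRing.maximalIdeal (locAtCentre A.toSubring O) ^ 2)))
    (h44c : ∀ (p : ℕ), p.Prime → ∀ (S : Scheme.{0}) [IsIntegral S] [IsNoetherian S],
      CharP S.functionField p → Scheme.IsRegular S → Scheme.IsExcellent S → topologicalKrullDim S = 3 →
      ∀ G₀ : S.functionField, (∀ s : S, CleanRegAt p (algebraMap (S.presheaf.stalk s) S.functionField) G₀) →
      ∀ I : S.IdealSheafData, I ≠ ⊥ →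
      ∀ (X : Scheme.{0}) (ρ : X ⟶ S) [IsIntegral X] [IsNoetherian X] [IsDominant ρ],
        IsCleanRegularCentreBlowupSeq p ρ I G₀ →
        (∀ x : X, CleanRegAt p (algebraMap (X.presheaf.stalk x) X.functionField) (RatFn.functionFieldMap ρ G₀)) →
        ∀ (J : X.IdealSheafData) (μ : ℕ), 1 ≤ μ →
          (∀ x ∈ J.support, 1 < Order.coheight x) → (∀ x, idealOrder J x ≤ μ) → (∃ x, idealOrder J x = μ) →
          ∃ (X' : Scheme.{0}) (π : X' ⟶ X) (_ : IsIntegral X') (_ : IsDominant π) (J' : X'.IdealSheafData),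
            IsCleanPermissibleSeq p π J μ J' (RatFn.functionFieldMap ρ G₀) ∧ ∀ x, idealOrder J' x < μ) :
    ∀ p : ℕ, p.Prime → ∀ (k : Type) [Field k] [CharP k p] (W : AlgebraicGeometry.Scheme.{0}) [AlgebraicGeometry.IsIntegral W] (f : W ⟶ AlgebraicGeometry.Spec (.of k)) (L : Type) [Field L] [Algebra W.functionField L], AlgebraicGeometry.IsSeparated f → AlgebraicGeometry.LocallyOfFiniteType f → AlgebraicGeometry.QuasiCompact f → Literature.AlgebraicGeometry.Resolution.Scheme.IsRegular W → IsPurelyInseparable W.functionField L → Module.finrank W.functionField L = p → topologicalKrullDim W ≤ ((3 : ℕ) : WithBot ℕ∞) → ∃ (V : AlgebraicGeometry.Scheme.{0}) (π : V ⟶ W) (_ : AlgebraicGeometry.IsIntegral V) (_ : AlgebraicGeometry.IsDominant π), AlgebraicGeometry.IsProper π ∧ Literature.AlgebraicGeometry.Resolution.IsBirational π ∧ Literature.AlgebraicGeometry.Resolution.Scheme.IsRegular V ∧ (∀ v : V, (∃ (y : L) (g : W.functionField), y ∉ Set.range (algebraMap W.functionField L) ∧ algebraMap W.functionField L g = y ^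 p ∧ ((∃ (d m : ℕ) (hmd : m ≤ d) (t : Fin d → V.presheaf.stalk v) (a : Fin m → ℕ), Ideal.span (Set.range t) = IsLocalRing.maximalIdeal (V.presheaf.stalk v) ∧ ringKrullDim (V.presheaf.stalk v) = (d : WithBot ℕ∞) ∧ 0 < m ∧ (∀ i, ¬ p ∣ a i) ∧ Literature.AlgebraicGeometry.Motives.RatFn.functionFieldMap π g = ∏ i : Fin m, (algebraMap (V.presheaf.stalk v) V.functionField (t (Fin.castLE hmd i))) ^ (a i)) ∨ (∃ u₀ : V.presheaf.stalk v, IsUnit u₀ ∧ Literature.AlgebraicGeometry.Motives.RatFn.functionFieldMap π g = algebraMap (V.presheaf.stalk v) V.functionField u₀ ∧ ((∀ c : V.presheaf.stalk v, u₀ - c ^ p ∉ IsLocalRing.maximalIdeal (V.presheaf.stalk v)) ∨ (∃ c : V.presheaf.stalk v, u₀ - c ^ p ∈ IsLocalRing.maximalIdeal (V.presheaf.stalk v) ∧ u₀ - c ^ p ∉ IsLocalRing.maximalIdeal (V.presheaf.stalk v) ^ 2)))))) := by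
  refine cleanModels_dimLE_of_cleanAlongValuation 3 hCAV (fun d h3 hd3 => ?_)
  obtain rfl : d = 3 := le_antisymm hd3 h3
  exact cleanTwoModelPatching_three_of_cleanProp44 h44c

end Summit.ResolutionOfSingularities.ResolutionOfSingularities.Theorems.RadicialJung.CleanModels.GradedAssembly

end
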